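import Summits.ABC.ABC.Theorems.ManyPrimeValuationProduct.Negative.WindowCensusFamily
import Mathlib.NumberTheory.Chebyshev

/-!
# `ManyPrimeValuationProduct` (stmt-ABC-1561), line `unramified-window-census`: the threshold of
`stub_midCensus` cannot be frozen — the coupling of the two `ε`

Negative support (drefute seat `refuter-drefute-stmt-ABC-1561-0`, 2026-08-16). `stub_midCensus` reads
`#{p ∥ N : ε · log log N < log v_p} · log log N ≤ ε · log N + C`: the same `ε` is the threshold EXPONENT
(primes with `v_p ≤ (log N)^ε` are not counted — the "free head" of the line, paid for by
`stub_omegaLogLog`) and the SLOPE of the bound. This file shows the two occurrences are genuinely coupled: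
with the threshold exponent frozen at `0` (count every multiplicative prime with `v_p ≥ 2`) the census bound
is FALSE for every slope `ε ≤ 1/5` (`midCensus_thresholdFree_false`). Witness: the Frey curves `F(n#, 1)` of
`Negative/WindowCensusFamily.lean` at `n = 4^k` — every odd prime `≤ n` is multiplicative with `v_p = 2`,
so the frozen census is `≥ (π(n) − 1) · log log N` with `log N ≍ θ(n)`, and Chebyshev's bounds
(`Chebyshev.pi_ge`, `Chebyshev.theta_ge`, `Chebyshev.theta_le_log4_mul_x`, Mathlib) give
`(π(n) − 1) log log N ≥ (0.86 − o(1)) · 4^k log 2` against `log N ≤ (4^{k+1} + 10) log 2`.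
(With the prime number theorem the same family refutes every slope `< 1/2`; the frozen census is TRUE
for slope `≥ 1.3841` by the maximal order of `ω`, `stub_omegaLogLog`.)  So no proof of `stub_midCensus`
can treat the threshold as a technicality: on near-primorial conductors `≫ ε log N / log log N`
multiplicative primes carry a non-trivial component group, and only the growth of `(log N)^ε` removes them.
-/

noncomputable section

-- `Summit.<Summit>.<Problem>`: for the single-conjunct summit `ABC` the duplicate `ABC.ABC` is mandated.
set_option linter.dupNamespace false

namespace Summit.ABC.ABC.Theorems.ManyPrimeValuationProduct.Negative

open Literature.NumberTheory.EllipticCurves UniqueFactorizationMonoid Real Finset Chebyshev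
open scoped Nat.Prime

/-! ## The conductor of `F(n#, 1)` against Chebyshev's `θ` -/

/-- `n# ∣ N (F(n#,1))` (the conductor is the radical of `32 · n# · (32 n# − 1)` and `n#` is squarefree).
[folklore] -/
theorem primorial_dvd_conductorNorm (n : ℕ) :
    primorial n ∣ (freyCurve (-1) (32 * ((primorial n : ℕ) : ℤ) ^ 1)).conductorNorm ℤ := by
  have hM : 1 ≤ primorial n := primorial_pos n
  rw [family_conductorNorm (primorial n) 1 hM]
  refine (UniqueFactorizationMonoid.dvd_radical_iff (squarefree_primorial n).isRadical
    (family_param_ne_zero (primorial n) 1 hM)).mpr ?_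
  exact Dvd.dvd.mul_right (Dvd.dvd.mul_left (by rw [pow_one]) 32) _

/-- `θ(n) ≤ log N (F(n#,1))`. [folklore] -/
theorem theta_le_log_conductorNorm (n : ℕ) :
    θ n ≤ Real.log ((freyCurve (-1) (32 * ((primorial n : ℕ) : ℤ) ^ 1)).conductorNorm ℤ) := by
  have hM : 1 ≤ primorial n := primorial_pos n
  haveI := family_isElliptic (primorial n) 1 hM
  have hle := Nat.le_of_dvd (WeierstrassCurve.conductorNorm_pos_holds _) (primorial_dvd_conductorNorm n)
  rw [theta_eq_log_primorial, Nat.floor_natCast]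
  exact Real.log_le_log (by exact_mod_cast primorial_pos n) (by exact_mod_cast hle)

/-- `log N (F(n#,1)) < 10 log 2 + 2 θ(n)` (`N ≤ 32 n# (32 n# − 1) < 2^{10} (n#)²`). [folklore] -/
theorem log_conductorNorm_lt (n : ℕ) :
    Real.log ((freyCurve (-1) (32 * ((primorial n : ℕ) : ℤ) ^ 1)).conductorNorm ℤ)
      < 10 * Real.log 2 + 2 * θ n := by
  have hM : 1 ≤ primorial n := primorial_pos n
  haveI := family_isElliptic (primorial n) 1 hM
  have hN0 := WeierstrassCurve.conductorNorm_pos_holds (freyCurve (-1) (32 * ((primorial n : ℕ) : ℤ) ^ 1))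
  have hle : (freyCurve (-1) (32 * ((primorial n : ℕ) : ℤ) ^ 1)).conductorNorm ℤ
      ≤ 32 * (primorial n) ^ 1 * (32 * (primorial n) ^ 1 - 1) := by
    rw [family_conductorNorm (primorial n) 1 hM]
    exact Nat.le_of_dvd (Nat.pos_of_ne_zero (family_param_ne_zero _ 1 hM)) radical_dvd_self
  have hlt : 32 * (primorial n) ^ 1 * (32 * (primorial n) ^ 1 - 1) < 2 ^ 10 * (primorial n) ^ 2 := by
    rw [pow_one]
    have h1 : 1 ≤ primorial n := hM
    have h2 : 32 * primorial n - 1 < 32 * primorial n := by omega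
    calc 32 * primorial n * (32 * primorial n - 1)
        < 32 * primorial n * (32 * primorial n) := (Nat.mul_lt_mul_left (by omega)).mpr h2
      _ = 2 ^ 10 * primorial n ^ 2 := by ring
  have hR : ((freyCurve (-1) (32 * ((primorial n : ℕ) : ℤ) ^ 1)).conductorNorm ℤ : ℝ)
      < (2 : ℝ) ^ 10 * ((primorial n : ℕ) : ℝ) ^ 2 := by exact_mod_cast lt_of_le_of_lt hle hlt
  have hP : (0 : ℝ) < primorial n := by exact_mod_cast primorial_pos n
  calc Real.log ((freyCurve (-1) (32 * ((primorial n : ℕ) : ℤ) ^ 1)).conductorNorm ℤ)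
      < Real.log ((2 : ℝ) ^ 10 * ((primorial n : ℕ) : ℝ) ^ 2) := Real.log_lt_log (by exact_mod_cast hN0) hR
    _ = 10 * Real.log 2 + 2 * Real.log (primorial n) := by
        rw [Real.log_mul (by positivity) (by positivity), Real.log_pow, Real.log_pow]; push_cast; ring
    _ = 10 * Real.log 2 + 2 * θ n := by rw [theta_eq_log_primorial, Nat.floor_natCast]

/-! ## Chebyshev at `n = 4^k` -/

/-- `16k ≤ 2^k` for `k ≥ 7`. [folklore] -/
theorem sixteen_mul_le_two_pow (k : ℕ) (hk : 7 ≤ k) : 16 * k ≤ 2 ^ k := by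
  induction k, hk using Nat.le_induction with
  | base => norm_num
  | succ m hm ih => rw [pow_succ]; omega

/-- `1000 (4k + 1) ≤ 4^k` for `k ≥ 12`. [folklore] -/
theorem four_pow_large (k : ℕ) (hk : 12 ≤ k) : 1000 * (4 * k + 1) ≤ 4 ^ k := by
  have h16 := sixteen_mul_le_two_pow k (by omega)
  have h2k : 2 ^ 12 ≤ 2 ^ k := Nat.pow_le_pow_right (by norm_num) hk
  have h4 : 4 ^ k = 2 ^ k * 2 ^ k := by rw [← mul_pow]; norm_num
  rw [h4]
  nlinarith

/-- `θ(4^k) ≥ 4^k · log 2 / 4` for `k ≥ 7` (from `Chebyshev.theta_ge`). [folklore] -/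
theorem theta_four_pow_ge (k : ℕ) (hk : 7 ≤ k) : (4 : ℝ) ^ k * Real.log 2 / 4 ≤ θ ((4 ^ k : ℕ) : ℝ) := by
  have h := theta_ge (4 ^ k)
  have h2 := Real.log_pos one_lt_two
  -- rewrite the three transcendental quantities at `n = 4^k`
  have hcast : ((4 ^ k : ℕ) : ℝ) = (4 : ℝ) ^ k := by push_cast; ring
  have hsqrt : Real.sqrt ((4 : ℝ) ^ k) = (2 : ℝ) ^ k := by
    rw [show (4 : ℝ) ^ k = ((2 : ℝ) ^ k) ^ 2 by rw [← pow_mul, mul_comm, pow_mul]; norm_num]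
    exact Real.sqrt_sq (by positivity)
  have hlog : Real.log ((4 : ℝ) ^ k) = 2 * k * Real.log 2 := by
    rw [Real.log_pow, show (4 : ℝ) = 2 ^ 2 by norm_num, Real.log_pow]; push_cast; ring
  have hlog1 : Real.log ((4 : ℝ) ^ k + 1) ≤ (2 * k + 1) * Real.log 2 := by
    have hX1 : (1 : ℝ) ≤ (4 : ℝ) ^ k := one_le_pow₀ (by norm_num)
    have : (4 : ℝ) ^ k + 1 ≤ 2 ^ (2 * k + 1) := by
      rw [pow_succ, pow_mul, show (2 : ℝ) ^ 2 = 4 by norm_num]; linarith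
    calc Real.log ((4 : ℝ) ^ k + 1) ≤ Real.log ((2 : ℝ) ^ (2 * k + 1)) :=
          Real.log_le_log (by positivity) this
      _ = (2 * k + 1) * Real.log 2 := by rw [Real.log_pow]; push_cast; ring
  rw [hcast] at h ⊢
  rw [hsqrt, hlog] at h
  -- `16k ≤ 2^k` gives `16k · 2^k ≤ 4^k` and `16k ≤ 4^k`
  have h16n := sixteen_mul_le_two_pow k hk
  have h16 : (16 : ℝ) * k * (2 : ℝ) ^ k ≤ (4 : ℝ) ^ k := by
    have : (16 : ℝ) * k ≤ (2 : ℝ) ^ k := by exact_mod_cast h16n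
    calc (16 : ℝ) * k * (2 : ℝ) ^ k ≤ (2 : ℝ) ^ k * (2 : ℝ) ^ k := by gcongr
      _ = (4 : ℝ) ^ k := by rw [← mul_pow]; norm_num
  have h16' : (16 : ℝ) * k ≤ (4 : ℝ) ^ k := by
    have h1 : (1 : ℝ) ≤ (2 : ℝ) ^ k := one_le_pow₀ (by norm_num)
    have hk0 : (0 : ℝ) ≤ 16 * k := by positivity
    nlinarith
  have hk1 : (1 : ℝ) ≤ k := by exact_mod_cast (show 1 ≤ k by omega)
  -- the two error terms against `4^k log 2`
  have hB : (2 * (k : ℝ) + 1) * Real.log 2 ≤ 3 / 16 * (4 : ℝ) ^ k * Real.log 2 := by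
    apply mul_le_mul_of_nonneg_right _ h2.le
    linarith
  have hC : 2 * (2 : ℝ) ^ k * (2 * k * Real.log 2) ≤ (4 : ℝ) ^ k * Real.log 2 / 4 := by
    have := mul_le_mul_of_nonneg_right h16 h2.le
    nlinarith
  nlinarith [hB, hC, hlog1, h]

/-- `θ(4^k) ≤ 4^k · log 4`. [folklore] -/
theorem theta_four_pow_le (k : ℕ) : θ ((4 ^ k : ℕ) : ℝ) ≤ Real.log 4 * (4 : ℝ) ^ k := by
  have h := theta_le_log4_mul_x (x := ((4 ^ k : ℕ) : ℝ)) (by positivity)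
  have hcast : ((4 ^ k : ℕ) : ℝ) = (4 : ℝ) ^ k := by push_cast; ring
  rwa [hcast] at h ⊢

/-- `π(4^k) − 1 ≥ (4^k − 4k − 1)/(2k)` for `k ≥ 1` (from `Chebyshev.pi_ge`). [folklore] -/
theorem primeCounting_four_pow_ge (k : ℕ) (hk : 1 ≤ k) :
    ((4 : ℝ) ^ k - 4 * k - 1) / (2 * k) ≤ (Nat.primeCounting (4 ^ k) : ℝ) - 1 := by
  have h := pi_ge (4 ^ k)
  have h2 := Real.log_pos one_lt_two
  have hcast : ((4 ^ k : ℕ) : ℝ) = (4 : ℝ) ^ k := by push_cast; ring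
  have hlog : Real.log ((4 : ℝ) ^ k) = 2 * k * Real.log 2 := by
    rw [Real.log_pow, show (4 : ℝ) = 2 ^ 2 by norm_num, Real.log_pow]; push_cast; ring
  have hlog1 : Real.log ((4 : ℝ) ^ k + 1) ≤ (2 * k + 1) * Real.log 2 := by
    have hX1 : (1 : ℝ) ≤ (4 : ℝ) ^ k := one_le_pow₀ (by norm_num)
    have : (4 : ℝ) ^ k + 1 ≤ 2 ^ (2 * k + 1) := by
      rw [pow_succ, pow_mul, show (2 : ℝ) ^ 2 = 4 by norm_num]; linarith
    calc Real.log ((4 : ℝ) ^ k + 1) ≤ Real.log ((2 : ℝ) ^ (2 * k + 1)) :=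
          Real.log_le_log (by positivity) this
      _ = (2 * k + 1) * Real.log 2 := by rw [Real.log_pow]; push_cast; ring
  rw [hcast, hlog] at h
  have hk0 : (0 : ℝ) < k := by exact_mod_cast hk
  -- `h : (4^k log 2 − log(4^k+1)) / (2k log 2) ≤ π`, and the numerator is `≥ (4^k − 2k − 1) log 2`
  have hnum : ((4 : ℝ) ^ k - 2 * k - 1) * Real.log 2 ≤ (4 : ℝ) ^ k * Real.log 2 - Real.log ((4 : ℝ) ^ k + 1) := by
    nlinarith
  have hdiv : ((4 : ℝ) ^ k - 2 * k - 1) / (2 * k) ≤ (Nat.primeCounting (4 ^ k) : ℝ) := by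
    calc ((4 : ℝ) ^ k - 2 * k - 1) / (2 * k)
        = ((4 : ℝ) ^ k - 2 * k - 1) * Real.log 2 / (2 * k * Real.log 2) := by
          field_simp
      _ ≤ ((4 : ℝ) ^ k * Real.log 2 - Real.log ((4 : ℝ) ^ k + 1)) / (2 * k * Real.log 2) := by
          gcongr
      _ ≤ _ := h
  have hsplit : ((4 : ℝ) ^ k - 4 * k - 1) / (2 * k) = ((4 : ℝ) ^ k - 2 * k - 1) / (2 * k) - 1 := by
    field_simp; ring
  rw [hsplit]
  linarith

/-! ## The frozen census is false for every slope `ε ≤ 1/5` -/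

/-- **The threshold exponent of `stub_midCensus` cannot be frozen at `0`**: for every `ε ≤ 1/5` there is no
`C` with `#{p ∥ N : v_p ≥ 2} · log log N ≤ ε log N + C` on the class (the stub's body with the threshold
`0 · log log N < log v_p` and the slope `ε` kept). Witness `F((4^k)#, 1)`, `k = ⌈C⌉₊ + 12`. [folklore] -/
theorem midCensus_thresholdFree_false (ε : ℝ) (hε : ε ≤ 1 / 5) :
    ¬ ∃ C : ℝ, ∀ (W : WeierstrassCurve ℚ) [W.IsElliptic],
      (∀ p : ℕ, p.Prime → p ≠ 2 → ¬ p ^ 2 ∣ W.conductorNorm ℤ) →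
      4 ≤ ((W.conductorNorm ℤ).primeFactors.filter
        (fun p => p ≠ 2 ∧ ¬ p ^ 2 ∣ W.conductorNorm ℤ)).card →
      ((((W.conductorNorm ℤ).primeFactors.filter (fun p => ¬ p ^ 2 ∣ W.conductorNorm ℤ)).filter
          (fun p => 0 * Real.log (Real.log (W.conductorNorm ℤ)) <
            Real.log ((W.minimalDiscriminantNorm ℤ).factorization p))).card : ℝ) *
        Real.log (Real.log (W.conductorNorm ℤ)) ≤ ε * Real.log (W.conductorNorm ℤ) + C := by
  rintro ⟨C, hC⟩
  obtain ⟨k, hk⟩ : ∃ k : ℕ, k = ⌈C⌉₊ + 12 := ⟨_, rfl⟩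
  have hk12 : 12 ≤ k := by omega
  obtain ⟨n, hn⟩ : ∃ n : ℕ, n = 4 ^ k := ⟨_, rfl⟩
  have hn11 : 11 ≤ n := by
    rw [hn]; exact le_trans (by norm_num) (Nat.pow_le_pow_right (by norm_num) hk12)
  have hM : 1 ≤ primorial n := primorial_pos n
  haveI := family_isElliptic (primorial n) 1 hM
  have h := hC (freyCurve (-1) (32 * ((primorial n : ℕ) : ℤ) ^ 1)) (family_semistable _ 1 hM)
    (family_four_le_card _ 1 hM le_rfl (dvd_primorial_1155 n hn11))
  -- (1) the frozen census counts every odd prime `≤ n`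
  have hcard := family_card_le (primorial n) 1 hM le_rfl ((Nat.primesLE n).filter (· ≠ 2))
    (oddPrimesLE_spec n)
    (fun p => 0 * Real.log (Real.log ((freyCurve (-1) (32 * ((primorial n : ℕ) : ℤ) ^ 1)).conductorNorm ℤ)) <
      Real.log (((freyCurve (-1) (32 * ((primorial n : ℕ) : ℤ) ^ 1)).minimalDiscriminantNorm ℤ).factorization p))
    (fun p _ hv => by
      rw [zero_mul]
      exact Real.log_pos (Nat.one_lt_cast.mpr (by omega)))
  rw [card_oddPrimesLE n (by omega)] at hcard
  have hcnt : (Nat.primeCounting n : ℝ) - 1 ≤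
      ((((freyCurve (-1) (32 * ((primorial n : ℕ) : ℤ) ^ 1)).conductorNorm ℤ).primeFactors.filter
        (fun p => ¬ p ^ 2 ∣ (freyCurve (-1) (32 * ((primorial n : ℕ) : ℤ) ^ 1)).conductorNorm ℤ)).filter
        (fun p => 0 * Real.log (Real.log ((freyCurve (-1) (32 * ((primorial n : ℕ) : ℤ) ^ 1)).conductorNorm ℤ)) <
          Real.log (((freyCurve (-1) (32 * ((primorial n : ℕ) : ℤ) ^ 1)).minimalDiscriminantNorm
            ℤ).factorization p))).card := by
    have h1 : 1 ≤ Nat.primeCounting n := by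
      rw [← Nat.primesLE_card_eq_primeCounting]
      exact Finset.card_pos.mpr ⟨2, Nat.mem_primesLE.mpr ⟨by omega, Nat.prime_two⟩⟩
    have := (Nat.cast_le (α := ℝ)).mpr hcard
    push_cast [Nat.cast_sub h1] at this
    linarith
  -- (2) Chebyshev at `n = 4^k`
  have hπ := primeCounting_four_pow_ge k (by omega)
  have hθlo := theta_four_pow_ge k (by omega)
  have hθhi := theta_four_pow_le k
  rw [← hn] at hπ hθlo hθhi
  have hLlo := theta_le_log_conductorNorm n
  have hLhi := log_conductorNorm_lt n
  have hbigR : (1000 * (4 * (k : ℝ) + 1)) ≤ (4 : ℝ) ^ k := by exact_mod_cast four_pow_large k hk12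
  -- (3) `log log N ≥ (2k − 3) log 2`
  have h2 := Real.log_pos one_lt_two
  have hl2 := Real.log_two_gt_d9
  have hl2' := Real.log_two_lt_d9
  have hX12 : (4 : ℝ) ^ 12 ≤ (4 : ℝ) ^ k := pow_le_pow_right₀ (by norm_num) hk12
  have hLL : (2 * k - 3) * Real.log 2 ≤
      Real.log (Real.log ((freyCurve (-1) (32 * ((primorial n : ℕ) : ℤ) ^ 1)).conductorNorm ℤ)) := by
    have hlow : (2 : ℝ) ^ (2 * k - 3) ≤ (4 : ℝ) ^ k * Real.log 2 / 4 := by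
      have hk3 : 2 * k - 3 + 3 = 2 * k := by omega
      have e1 : (2 : ℝ) ^ (2 * k - 3) * 2 ^ 3 = (4 : ℝ) ^ k := by
        rw [← pow_add, hk3, pow_mul]; norm_num
      nlinarith [e1]
    have hpos : (0 : ℝ) < (2 : ℝ) ^ (2 * k - 3) := by positivity
    calc (2 * k - 3 : ℝ) * Real.log 2 = Real.log ((2 : ℝ) ^ (2 * k - 3)) := by
          rw [Real.log_pow]; push_cast [Nat.cast_sub (show 3 ≤ 2 * k by omega)]; ring
      _ ≤ Real.log (Real.log ((freyCurve (-1) (32 * ((primorial n : ℕ) : ℤ) ^ 1)).conductorNorm ℤ)) :=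
          Real.log_le_log hpos (hlow.trans (hθlo.trans hLlo))
  -- (4) assemble: count ≥ (4^k − 4k − 1)/(2k), log log N ≥ (2k − 3) log 2, log N ≤ (10 + 4^{k+1}) log 2
  have hk0 : (0 : ℝ) < k := by exact_mod_cast (show 0 < k by omega)
  have hkk : (12 : ℝ) ≤ k := by exact_mod_cast hk12
  have hcntlo : ((4 : ℝ) ^ k - 4 * k - 1) / (2 * k) ≤ _ := hπ.trans hcnt
  have hcnt0 : (0 : ℝ) ≤ ((4 : ℝ) ^ k - 4 * k - 1) / (2 * k) := by
    apply div_nonneg _ (by positivity)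
    linarith
  have hLLpos : (0 : ℝ) ≤ (2 * k - 3) * Real.log 2 := by nlinarith
  -- product of the two lower bounds
  have hprod : ((4 : ℝ) ^ k - 4 * k - 1) / (2 * k) * ((2 * k - 3) * Real.log 2) ≤
      ((((freyCurve (-1) (32 * ((primorial n : ℕ) : ℤ) ^ 1)).conductorNorm ℤ).primeFactors.filter
        (fun p => ¬ p ^ 2 ∣ (freyCurve (-1) (32 * ((primorial n : ℕ) : ℤ) ^ 1)).conductorNorm ℤ)).filter
        (fun p => 0 * Real.log (Real.log ((freyCurve (-1) (32 * ((primorial n : ℕ) : ℤ) ^ 1)).conductorNorm ℤ)) <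
          Real.log (((freyCurve (-1) (32 * ((primorial n : ℕ) : ℤ) ^ 1)).minimalDiscriminantNorm
            ℤ).factorization p))).card *
      Real.log (Real.log ((freyCurve (-1) (32 * ((primorial n : ℕ) : ℤ) ^ 1)).conductorNorm ℤ)) :=
    mul_le_mul hcntlo hLL hLLpos (hcnt0.trans hcntlo)
  -- the elementary inequality `(4^k − 4k − 1)(2k − 3)/(2k) ≥ 0.86 · 4^k` for `k ≥ 12`
  have hkey : (0.86 : ℝ) * (4 : ℝ) ^ k ≤ ((4 : ℝ) ^ k - 4 * k - 1) / (2 * k) * (2 * k - 3) := by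
    rw [div_mul_eq_mul_div, le_div_iff₀ (by positivity)]
    -- 0.86·4^k·2k ≤ (4^k − 4k − 1)(2k − 3)  ⟸  1000 (4k+1) ≤ 4^k and k ≥ 12
    nlinarith [hbigR, hkk, hX12]
  -- upper bound of the right-hand side
  have hL : Real.log ((freyCurve (-1) (32 * ((primorial n : ℕ) : ℤ) ^ 1)).conductorNorm ℤ)
      ≤ (10 + 4 * (4 : ℝ) ^ k) * Real.log 2 := by
    have hlog4 : Real.log 4 = 2 * Real.log 2 := by
      rw [show (4 : ℝ) = 2 ^ 2 by norm_num, Real.log_pow]; push_cast; ring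
    rw [hlog4] at hθhi
    linarith
  have hLnonneg : 0 ≤ Real.log ((freyCurve (-1) (32 * ((primorial n : ℕ) : ℤ) ^ 1)).conductorNorm ℤ) :=
    Real.log_natCast_nonneg _
  have hεL : ε * Real.log ((freyCurve (-1) (32 * ((primorial n : ℕ) : ℤ) ^ 1)).conductorNorm ℤ)
      ≤ 1 / 5 * ((10 + 4 * (4 : ℝ) ^ k) * Real.log 2) := by
    calc ε * _ ≤ 1 / 5 * Real.log ((freyCurve (-1) (32 * ((primorial n : ℕ) : ℤ) ^ 1)).conductorNorm ℤ) :=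
          mul_le_mul_of_nonneg_right hε hLnonneg
      _ ≤ _ := by gcongr
  -- growth: `C ≤ k ≤ 4^k / 4000`
  have hCk : C ≤ (k : ℝ) := by
    have : (⌈C⌉₊ : ℝ) ≤ k := by rw [hk]; push_cast; linarith
    exact (Nat.le_ceil C).trans this
  have hprod' : (0.86 : ℝ) * (4 : ℝ) ^ k * Real.log 2 ≤
      ((((freyCurve (-1) (32 * ((primorial n : ℕ) : ℤ) ^ 1)).conductorNorm ℤ).primeFactors.filter
        (fun p => ¬ p ^ 2 ∣ (freyCurve (-1) (32 * ((primorial n : ℕ) : ℤ) ^ 1)).conductorNorm ℤ)).filter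
        (fun p => 0 * Real.log (Real.log ((freyCurve (-1) (32 * ((primorial n : ℕ) : ℤ) ^ 1)).conductorNorm ℤ)) <
          Real.log (((freyCurve (-1) (32 * ((primorial n : ℕ) : ℤ) ^ 1)).minimalDiscriminantNorm
            ℤ).factorization p))).card *
      Real.log (Real.log ((freyCurve (-1) (32 * ((primorial n : ℕ) : ℤ) ^ 1)).conductorNorm ℤ)) := by
    have := mul_le_mul_of_nonneg_right hkey h2.le
    calc (0.86 : ℝ) * (4 : ℝ) ^ k * Real.log 2
        ≤ ((4 : ℝ) ^ k - 4 * k - 1) / (2 * k) * (2 * k - 3) * Real.log 2 := this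
      _ = ((4 : ℝ) ^ k - 4 * k - 1) / (2 * k) * ((2 * k - 3) * Real.log 2) := by ring
      _ ≤ _ := hprod
  have hXl : (4 : ℝ) ^ k * 0.6931471803 ≤ (4 : ℝ) ^ k * Real.log 2 :=
    mul_le_mul_of_nonneg_left hl2.le (by positivity)
  linarith [hprod', h, hεL, hCk, hbigR, hXl, hX12, h2]

end Summit.ABC.ABC.Theorems.ManyPrimeValuationProduct.Negative

end
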